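import Summits.Ventures.LatticeQCDFlow.Exactness.IMHCoupledEstimatorBernsteinUnboundedWeights
import Summits.Ventures.LatticeQCDFlow.Exactness.IMHFlowDivergenceDictionary
import HarnessLib

/-!
# The coupling term and the bias allowance in the flow's own figures of merit: with `1 + χ² = ∫ w² dq = 1/ESS` and `c₁ = E_q[min(1, w)] ≥ ā`,
# `P(X_k ≠ X′_k) ≤ (1 + χ²)/M² + (1 − c₁/M)^k` and `π{w > M} ≤ (1 + χ²)/M` for every `M ≥ max(1, w(x))` — so
# `P(|H̄_R − π f| ≥ ε + (c − a)((1 + χ²)/M + (1 − c₁/M)^k)) ≤ 2·exp(−Rε²/(2(σ² + (c − a)ε/3))) + R·((1 + χ²)/M² + (1 − c₁/M)^k)`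

HONEST FRAMING: exact (Metropolis-corrected) sampling algorithms for lattice gauge theory;
figures of merit are autocorrelation/cost numbers at stated couplings and volumes; no
continuum-physics claim.

Venture `LatticeQCDFlow` (cell pub-lqcd), topic `Exactness`; FANOUT row 30 (lean-1, GEN-40).  NEW WORK of the cell, general
(standard Borel) state space, EVERY proposal law `q`, every positive normalised weight `w` IN `L²(q)` — i.e. finite `χ²`-divergence
`χ²(π‖q) = ∫(w − 1)² dq`, equivalently a positive effective sample size `ESS = 1/(1 + χ²)`, the number every flow paper reports — and
NO BOUND on `w`.  GEN-40's `IMHCoupledEstimatorBernsteinUnboundedWeights` gave the coupling term `q{w > M} + ρ^k` and the bias allowance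
`(c − a)(π{w > M} + ρ^k)` (`ρ = 1 − c₁/max(1, M)`) at a free level `M ≥ w(x)`; `IMHFlowDivergenceDictionary` gave `∫ w² dq = 1 + χ²`.
Markov's inequality turns both weight tails into numbers the practitioner has:

* §1 **`measure_weight_gt_le_lintegral_sq_div`** — `q{M < w} ≤ (∫ w² dq)/M²` (`M > 0`, `ℝ≥0∞`); **`target_weight_gt_le_lintegral_sq_div`** —
  `π{M < w} ≤ (∫ w² dq)/M`; **`measure_weight_gt_le_chiSq`**, **`target_weight_gt_le_chiSq`** — the same with `∫ w² dq = 1 + χ²` for `w ∈ L²(q)`.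
* §2 **`iterate_bind_crnPair_offDiagonal_detLag_le_chiSq`** — from the practical start (production run at `x`, leading run one update ahead),
  for every `M ≥ max(1, w(x))` and every `k`: `P(X_k ≠ X′_k) ≤ (1 + χ²)/M² + (1 − c₁/M)^k`.
* §3 **`crnLag_replicas_burnIn_bernstein_abs_target_chiSq`** — `R` independent coupled pairs, window `N`, burn-in `k`, `σ² ≥ Var_{δ_xK^k} f > 0`,
  `ε ≥ 0`, `R ≥ 1`, every `M ≥ max(1, w(x))`:
  `P(|H̄_R − π f| ≥ ε + (c − a)((1 + χ²)/M + (1 − c₁/M)^k)) ≤ 2·exp(−Rε²/(2(σ² + (c − a)ε/3))) + R·((1 + χ²)/M² + (1 − c₁/M)^k)`.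
Reading (gauge files): for a flow with effective sample size `ESS` and printed acceptance `ā ≤ c₁`, coupled pairs of two exact gauge samplers
on one stream of random numbers started at `x` certify the burn-in-free average with a coupling term `R·(1/(ESS·M²) + (1 − c₁/M)^k)` and a
bias allowance `(c − a)(1/(ESS·M) + (1 − c₁/M)^k)` at any declared level `M ≥ max(1, w(x))` — e.g. `M = √(2R/(δ·ESS))` and
`k ≥ M·log(4R/δ)/c₁` make the coupling term `≤ δ`.
NOT CLAIMED: an optimal choice of `M`; `σ²` in terms of `Var_π f` here (see `IMHCoupledEstimatorEquilibriumBernsteinUnboundedWeights`);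
anything for unbounded `f`.  No `sorry`, no new definitions, nothing cited as a fact.
-/

noncomputable section

namespace Summit.Ventures.LatticeQCDFlow.Exactness

open MeasureTheory ProbabilityTheory Function Finset Filter
open scoped _root_.ENNReal unitInterval Topology
open Summit.Ventures.LatticeQCDFlow.Scoring

variable {Ω : Type*} [MeasurableSpace Ω] {q : Measure Ω} [IsProbabilityMeasure q] {w : Ω → ℝ}

/-! ## §1 Markov: the weight tails in terms of the second moment `1 + χ²` -/

omit [IsProbabilityMeasure q] in
/-- **`q{M < w} ≤ (∫ w² dq)/M²`** for `M > 0` (`ℝ≥0∞`; Markov on `w²`). [ours, bookkeeping] -/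
theorem measure_weight_gt_le_lintegral_sq_div (hw : Measurable w) {M : ℝ} (hM : 0 < M) :
    q {y | M < w y} ≤ (∫⁻ y, ENNReal.ofReal (w y ^ 2) ∂q) / ENNReal.ofReal (M ^ 2) := by
  have hsub : {y | M < w y} ⊆ {y | ENNReal.ofReal (M ^ 2) ≤ ENNReal.ofReal (w y ^ 2)} := fun y hy => by
    simp only [Set.mem_setOf_eq] at hy ⊢
    exact ENNReal.ofReal_le_ofReal (pow_le_pow_left₀ hM.le hy.le 2)
  refine (measure_mono hsub).trans ?_
  exact meas_ge_le_lintegral_div (hw.pow_const 2).ennreal_ofReal.aemeasurable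
    (ne_of_gt (ENNReal.ofReal_pos.2 (by positivity))) ENNReal.ofReal_ne_top

omit [IsProbabilityMeasure q] in
/-- **`π{M < w} ≤ (∫ w² dq)/M`** for `M > 0` (`π = w·q`; on `{w > M}` one has `w ≤ w²/M`). [ours, bookkeeping] -/
theorem target_weight_gt_le_lintegral_sq_div (hw : Measurable w) (hw0 : ∀ y, 0 < w y) {M : ℝ} (hM : 0 < M) :
    (q.withDensity fun y => ENNReal.ofReal (w y)) {y | M < w y} ≤ (∫⁻ y, ENNReal.ofReal (w y ^ 2) ∂q) / ENNReal.ofReal M := by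
  have hSm : MeasurableSet {y | M < w y} := measurableSet_lt measurable_const hw
  have hMne : ENNReal.ofReal M ≠ 0 := ne_of_gt (ENNReal.ofReal_pos.2 hM)
  rw [withDensity_apply _ hSm]
  -- on `{M < w}`: `w ≤ w²/M`
  have hpt : ∀ y ∈ {y | M < w y}, ENNReal.ofReal (w y) ≤ ENNReal.ofReal (w y ^ 2) / ENNReal.ofReal M := by
    intro y hy
    simp only [Set.mem_setOf_eq] at hy
    rw [ENNReal.le_div_iff_mul_le (Or.inl hMne) (Or.inl ENNReal.ofReal_ne_top), ← ENNReal.ofReal_mul (hw0 y).le]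
    exact ENNReal.ofReal_le_ofReal (by nlinarith [hw0 y])
  calc ∫⁻ y in {y | M < w y}, ENNReal.ofReal (w y) ∂q
      ≤ ∫⁻ y in {y | M < w y}, ENNReal.ofReal (w y ^ 2) / ENNReal.ofReal M ∂q := setLIntegral_mono' hSm hpt
    _ ≤ ∫⁻ y, ENNReal.ofReal (w y ^ 2) / ENNReal.ofReal M ∂q := setLIntegral_le_lintegral _ _
    _ = (∫⁻ y, ENNReal.ofReal (w y ^ 2) ∂q) / ENNReal.ofReal M := by
        simp only [div_eq_mul_inv]
        rw [lintegral_mul_const _ (hw.pow_const 2).ennreal_ofReal]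

/-- **`q{M < w} ≤ (1 + χ²)/M²`** for `w ∈ L²(q)` normalised, `χ² = ∫(w − 1)² dq`, `M > 0`. [ours] -/
theorem measure_weight_gt_le_chiSq (hw : Measurable w) (hmem : MemLp w 2 q) (h1 : ∫ y, w y ∂q = 1) {M : ℝ} (hM : 0 < M) :
    q {y | M < w y} ≤ ENNReal.ofReal (1 + ∫ y, (w y - 1) ^ 2 ∂q) / ENNReal.ofReal (M ^ 2) := by
  rw [← lintegral_sq_eq_ofReal_one_add_chiSq hmem h1]
  exact measure_weight_gt_le_lintegral_sq_div hw hM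

/-- **`π{M < w} ≤ (1 + χ²)/M`** for `w ∈ L²(q)` normalised and positive, `M > 0`. [ours] -/
theorem target_weight_gt_le_chiSq (hw : Measurable w) (hw0 : ∀ y, 0 < w y) (hmem : MemLp w 2 q) (h1 : ∫ y, w y ∂q = 1)
    {M : ℝ} (hM : 0 < M) :
    (q.withDensity fun y => ENNReal.ofReal (w y)) {y | M < w y} ≤ ENNReal.ofReal (1 + ∫ y, (w y - 1) ^ 2 ∂q) / ENNReal.ofReal M := by
  rw [← lintegral_sq_eq_ofReal_one_add_chiSq hmem h1]
  exact target_weight_gt_le_lintegral_sq_div hw hw0 hM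

/-! ## §2 The practical coupling merges at a rate set by `χ²` and `c₁` -/

/-- **`P(X_k ≠ X′_k) ≤ (1 + χ²)/M² + (1 − c₁/M)^k`** from the practical start (`ν̂_x = K(x, ·)∘(y ↦ (y, x))⁻¹`), for every
`M ≥ max(1, w(x))` and every `k` (`w ∈ L²(q)` normalised; `c₁ = E_q[min(1, w)]`; `ℝ≥0∞`). [ours] -/
theorem iterate_bind_crnPair_offDiagonal_detLag_le_chiSq [StandardBorelSpace Ω] [Nonempty Ω] [MeasurableSingletonClass Ω]
    [MeasurableEq Ω] (hw : Measurable w) (hw0 : ∀ y, 0 < w y) (hmem : MemLp w 2 q) (h1 : ∫ y, w y ∂q = 1)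
    (Khat : Kernel (Ω × Ω) (Ω × Ω)) [IsMarkovKernel Khat]
    (hK : ∀ z : Ω × Ω, Khat z = (q.prod (volume : Measure unitInterval)).map (fun p : Ω × unitInterval =>
      ((if (p.2 : ℝ) * w z.1 ≤ w p.1 then p.1 else z.1), (if (p.2 : ℝ) * w z.2 ≤ w p.1 then p.1 else z.2))))
    (x : Ω) {M : ℝ} (hM : max 1 (w x) ≤ M) (ν : Measure (Ω × Ω)) [IsProbabilityMeasure ν]
    (hν : ν = (indepMH q w x).map fun y : Ω => (y, x)) (k : ℕ) :
    ((fun m : Measure (Ω × Ω) => m.bind Khat)^[k] ν) (Set.diagonal Ω)ᶜ ≤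
      ENNReal.ofReal (1 + ∫ y, (w y - 1) ^ 2 ∂q) / ENNReal.ofReal (M ^ 2) +
        (1 - (∫⁻ y, ENNReal.ofReal (min 1 (w y)) ∂q) / ENNReal.ofReal M) ^ k := by
  have hM1 : 1 ≤ M := (le_max_left _ _).trans hM
  have hxM : w x ≤ M := (le_max_right _ _).trans hM
  have h := iterate_bind_crnPair_offDiagonal_detLag_le_tail hw hw0 Khat hK x hxM ν hν k
  rw [max_eq_right hM1] at h
  exact h.trans (add_le_add (measure_weight_gt_le_chiSq hw hmem h1 (by linarith)) le_rfl)

section Replicas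

variable {Ω' : Type*} {mΩ' : MeasurableSpace Ω'} {μ : Measure Ω'} [IsProbabilityMeasure μ]
  {Z : ℕ → Ω' → (ℕ → Ω × Ω)}

/-! ## §3 The Bernstein bar in the flow's own figures of merit -/

/-- **THE BERNSTEIN BAR ABOUT `π f` IN TERMS OF `χ²` AND `c₁`**: standard Borel `Ω`, `w ∈ L²(q)` positive and normalised (`1 + χ² = ∫ w² dq`);
production run at `x`, leading run one update ahead, `R` independent coupled pairs, window `N`, burn-in `k`, `σ² ≥ Var_{δ_xK^k} f > 0`,
`ε ≥ 0`, `R ≥ 1`; for every level `M ≥ max(1, w(x))`: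
`P(|H̄_R − π f| ≥ ε + (c − a)((1 + χ²)/M + (1 − c₁/M)^k)) ≤ 2·exp(−Rε²/(2(σ² + (c − a)ε/3))) + R·((1 + χ²)/M² + (1 − c₁/M)^k)`. [ours] -/
theorem crnLag_replicas_burnIn_bernstein_abs_target_chiSq [StandardBorelSpace Ω] [Nonempty Ω] [MeasurableSingletonClass Ω]
    [MeasurableEq Ω] [Fact (Measurable w)] (hw0 : ∀ y, 0 < w y) (hmem : MemLp w 2 q) (h1 : ∫ y, w y ∂q = 1)
    [IsProbabilityMeasure (q.withDensity fun y => ENNReal.ofReal (w y))]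
    (Khat : Kernel (Ω × Ω) (Ω × Ω)) [IsMarkovKernel Khat]
    (hK : ∀ z : Ω × Ω, Khat z = (q.prod (volume : Measure unitInterval)).map (fun p : Ω × unitInterval =>
      ((if (p.2 : ℝ) * w z.1 ≤ w p.1 then p.1 else z.1), (if (p.2 : ℝ) * w z.2 ≤ w p.1 then p.1 else z.2))))
    (x : Ω) {M : ℝ} (hM : max 1 (w x) ≤ M) (ν : Measure (Ω × Ω)) [IsProbabilityMeasure ν]
    (hν : ν = (indepMH q w x).map fun y : Ω => (y, x)) {f : Ω → ℝ} (hf : Measurable f) {a c : ℝ} (ha : ∀ y, a ≤ f y)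
    (hc : ∀ y, f y ≤ c) (k N : ℕ) (hZm : ∀ j, Measurable (Z j))
    (hlaw : ∀ j, μ.map (Z j) = Kernel.trajMeasure (X := fun _ : ℕ => Ω × Ω) ν
      (fun n : ℕ => Khat.comap (fun h : (i : ↥(Finset.Iic n)) → Ω × Ω => h ⟨n, Finset.mem_Iic.2 le_rfl⟩)
        (measurable_pi_apply _)))
    (hind : iIndepFun Z μ) {σ2 : ℝ} (hσ : 0 < σ2)
    (hσk : variance f ((fun m : Measure Ω => m.bind (indepMH q w))^[k] (Measure.dirac x)) ≤ σ2)
    {ε : ℝ} (hε : 0 ≤ ε) {R : ℕ} (hR : 1 ≤ R) :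
    μ.real {ω | ε + (c - a) * (ENNReal.ofReal (1 + ∫ y, (w y - 1) ^ 2 ∂q) / ENNReal.ofReal M +
          (1 - (∫⁻ y, ENNReal.ofReal (min 1 (w y)) ∂q) / ENNReal.ofReal M) ^ k).toReal ≤
        |(R : ℝ)⁻¹ * ∑ j ∈ range R, (f ((Z j ω k).2) + ∑ n ∈ range N, (f ((Z j ω (k + n)).1) - f ((Z j ω (k + n)).2))) -
          ∫ y, f y ∂(q.withDensity fun y => ENNReal.ofReal (w y))|} ≤
      2 * Real.exp (-(R * ε ^ 2) / (2 * (σ2 + (c - a) * ε / 3))) +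
        R * (ENNReal.ofReal (1 + ∫ y, (w y - 1) ^ 2 ∂q) / ENNReal.ofReal (M ^ 2) +
          (1 - (∫⁻ y, ENNReal.ofReal (min 1 (w y)) ∂q) / ENNReal.ofReal M) ^ k).toReal := by
  have hw : Measurable w := Fact.out
  have hM1 : 1 ≤ M := (le_max_left _ _).trans hM
  have hxM : w x ≤ M := (le_max_right _ _).trans hM
  have hM0 : 0 < M := by linarith
  have hca : 0 ≤ c - a := by linarith [ha x, hc x]
  set πm : Measure Ω := q.withDensity fun y => ENNReal.ofReal (w y) with hπm
  set C : ℝ≥0∞ := ENNReal.ofReal (1 + ∫ y, (w y - 1) ^ 2 ∂q) with hC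
  set r : ℝ≥0∞ := (1 - (∫⁻ y, ENNReal.ofReal (min 1 (w y)) ∂q) / ENNReal.ofReal M) ^ k with hr
  have hr1 : r ≤ 1 := (pow_le_pow_left' tsub_le_self k).trans_eq (one_pow k)
  have hrT : r ≠ ⊤ := ne_top_of_le_ne_top ENNReal.one_ne_top hr1
  have hCM : C / ENNReal.ofReal M ≠ ⊤ := ENNReal.div_ne_top ENNReal.ofReal_ne_top (ne_of_gt (ENNReal.ofReal_pos.2 hM0))
  have hCM2 : C / ENNReal.ofReal (M ^ 2) ≠ ⊤ :=
    ENNReal.div_ne_top ENNReal.ofReal_ne_top (ne_of_gt (ENNReal.ofReal_pos.2 (by positivity)))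
  -- the every-weight bar at level `M` (there `max 1 M = M`)
  have h := crnLag_replicas_burnIn_bernstein_abs_target_everyWeight hw0 Khat hK x hxM ν hν hf ha hc k N hZm hlaw hind hσ hσk hε hR
  rw [max_eq_right hM1] at h
  -- the two weight tails by Markov
  have htail_q : (q {y | M < w y} + r).toReal ≤ (C / ENNReal.ofReal (M ^ 2) + r).toReal :=
    ENNReal.toReal_mono (ENNReal.add_ne_top.2 ⟨hCM2, hrT⟩)
      (add_le_add (measure_weight_gt_le_chiSq hw hmem h1 hM0) le_rfl)
  have htail_π : (πm {y | M < w y} + r).toReal ≤ (C / ENNReal.ofReal M + r).toReal :=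
    ENNReal.toReal_mono (ENNReal.add_ne_top.2 ⟨hCM, hrT⟩)
      (add_le_add (target_weight_gt_le_chiSq hw hw0 hmem h1 hM0) le_rfl)
  have hRnn : (0 : ℝ) ≤ R := Nat.cast_nonneg R
  refine le_trans (le_trans (measureReal_mono fun ω hω => ?_) h) ?_
  · simp only [Set.mem_setOf_eq] at hω ⊢
    have := mul_le_mul_of_nonneg_left htail_π hca
    linarith
  · gcongr

end Replicas

end Summit.Ventures.LatticeQCDFlow.Exactness

end
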